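import Summits.Ventures.GridStability.Models.NE39LFaultOnCase5Tube
import Summits.Ventures.GridStability.Lyapunov.RelativeLffLevelTest
import Summits.Ventures.GridStability.Lyapunov.NE39LPostCase5Lff
import HarnessLib

/-!
# Bench/NE39LCase5CctLower — «G1cct-NE39L-LOWER-K-BUS14»: a CERTIFIED clearing-time LOWER BOUND for the New England 10-machine
# model NE39L (Padiyar 2013 Table 4.1 case 5: bolted fault at bus 14, line 14–34 TRIPPED at clearing (post-fault object NE39LPostCase5 ≠ pre-fault; feature (b))) — CCT(M′_NE39L) ≥ 43/400 s = 0.1075 s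

Venture GRIDFUSION (LADDER-GRIDFUSION G1-cct next wave; lead g8 RULINGs 9aa (3) / 9ar (1) / 9as (3) / 9bb (1); seat gridfusion-model-1 g8).  Pattern of
`Bench/NE39LBus37CctLower.lean` (p559847, #121-cand).  COMPOSITION, kernel-only, zero kit, zero facts:
(1) model-1's 40-leg KERNEL FAULT-ON TUBE `NE39L.FaultCase5.clearingState40` (`Models/NE39LFaultOnCase5Tube.lean`; SwingQ packet == model-4
    `bench/data/NE39/faulton-cases-h12.json` 7674c1ecf75cb0f9 block of this case / `swingq-ne39L…bus14.json` BY VALUE): for every `T` in slice `s`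
    (`s < 43`, `[s/400, (s+1)/400] s`) the clearing state `Y(T)` of every fault-on motion from the synchronous equilibrium of M′ lies in `c5sliceBoxAt s`;
(2) the DECIDABLE «K ⊂ S» test of `Lyapunov/RelativeLffLevelTest.lean` (model-1 g8, p557192): `c5sliceTest s` = slice admissible ∧ `boxOKQ` ∧ `polyOKQ` ∧
    `VhiQ < (2/λ + λ/2)·L_U` — all 43 by `decide` (4 decides); by `RelativeLff.certU_V_le_VhiQ` / `lffState_mem_polytope_of_polyOKQ` the LFF state
    of `Y(T)` lies in `{y ∈ 𝒫 | V_{1/10} y ≤ c₀}` with `c₀ = VhiQ(slice) < −1348.2422`;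
(3) lyap-1's EXPLICIT-LEVEL SYNCHRONISATION THEOREM `NE39LPostCase5Lff.levelU_synchronisation` (p493380, closed form `certU (1/10)`, `L_U = −67.244`,
    Vu–Turitsyn LFF [cite: VuTuritsyn2016, §IV set ℛ]).
HEADLINE `cct_lower` / `cct_lower_sync`: for every `T ∈ [0, 43/400]`, every fault-on motion `Y` (model `NE39L.FaultCase5.c5model`, from relative
angles `θ*` and zero speeds) on `[0, T]` and every motion `c` of M′_post = `NE39LPostCase5.data.toModelRel (1/10) 0` on `ℝ` with `c 0 = Y T`: `c` stays in a certified
LFF level set (of the POST-fault object) inside the polytope and SYNCHRONISES with the POST-fault SEP (`(δ_m − δ_0)(t) → θ*_m − θ*_0`, `(ω_m − ω_0)(t) → 0`).  I.e. the critical clearing time OF THE MODEL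
for this fault is at least `0.1075 s` (threshold sense).
WHERE IT STOPS (numbers): `V(θ*, 0) ≈ −1357.28`, admissible levels `< −1348.2422` ⇒ budget ≈ 9.04 V-units; the PRE-fault equilibrium of record lies INSIDE the post-case-5 certified set at T = 0 (margin 8.12 of budget ≈ 8.30 V-units: V_post(θ*_post, 0) ≈ −1354.6, level (401/20)·(−67147/1000) = −1346.297); 43 half-leg slices pass (tightest certified margin 0.163 at [0.105, 0.1075] s), slice 43 ([0.1075, 0.11] s) fails by 0.21. Other topology-change cases at T = 0: case 3 inside (1.40 vs 4.08), case 4 inside (2.02 vs 6.32), case 6 OUTSIDE already at T = 0 (4.84 vs 2.36 ⇒ no row with that certificate).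
THREE COLUMNS.  CERTIFIED (kernel, standard axioms): the sentences below for the MODEL pair (fault-on M′_F = `NE39L.FaultCase5.c5model`, post-fault
M′_post = `NE39LPostCase5.data.toModelRel (1/10) 0`, initial condition = the PRE-fault equilibrium `NE39L.data.angleOf` at zero speed).  MODELLED — LABEL OF EVERY MENTION (lead, NE39L lane): «synthetic VARIANT (conductances dropped,
lossless REDISPATCH at the printed operating angles), not a sentence about the printed New England system»; tokens MV-2L + MV-RD + MV-λ(1/10) +
MV-h12 (+ E6, ω_R = 377); COI acceleration ≡ 0 (lossless redispatch); line 14–34 TRIPPED ⇒ the post-fault object `NE39LPostCase5` (its own lossless redispatch `P′` and SEP) ≠ the pre-fault one — feature (b): the fault-on model carries the POST-fault `P′` and starts at the PRE-fault equilibrium of record; the bound is an INNER estimate through ONE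
Lyapunov level set; CCT statements here are MODEL statements, never the system's CCT.  VALIDATED (never certified): (i) SAME model pair, float RK4
(model-1 g8 `HOME/models/model-1/g8/rk4_cct_ne39L*.py`, h = 1 ms, pole slip := some |u_i| > π within 10 s): not computed for this case (the same-model float CCTs of the no-trip cases were 0.43–1.08 s); (ii) print (different model):
Padiyar's Table 4.1 case-5 entry (bus 14, line 14–34 tripped; detailed-model CCT 0.34–0.35 s, §4.4.2 [cite: Padiyar2013, Table 4.1]) is a comparator for a different (detailed / lossy) model.  No sentence of this file says a machine or a grid is stable.  [cite: Padiyar2013, Table 4.1; Moore1979, §8.1 eq. (8.10)]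
-/

noncomputable section

open Set Filter Topology Real
open Summit.Ventures.GridStability.Models
open Summit.Ventures.GridStability.Models.NE39L.FaultCase5
open Summit.Ventures.GridStability.Lyapunov

namespace Summit.Ventures.GridStability.Bench.NE39LCase5Cct

/-! ### §1 The 43 clearing-time slices of width 1/400 s and their decidable tests -/

/-- Offset of slice `s` inside its leg `s / 2`: `0` or `1/400`. -/
def c5sliceA (s : ℕ) : ℚ := ((s % 2 : ℕ) : ℚ) / 400

/-- End offset of slice `s` inside its leg: `c5sliceA s + 1/400`. -/
def c5sliceB (s : ℕ) : ℚ := ((s % 2 : ℕ) : ℚ) / 400 + 1 / 400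

/-- The sign-free clearing-state box of slice `s` (relative rotor angles `δ_i − δ_0`, speeds): leg `s / 2` of the tube, offsets
`[c5sliceA s, c5sliceB s]`. -/
def c5sliceBoxAt (s : ℕ) : SwingTube.SliceBox 10 :=
  (SwingTube.legAt c5legs40 (s / 2)).sliceBox (SwingTube.kboxAt case5K0 c5legs40 (s / 2)) (c5sliceA s) (c5sliceB s)

/-- THE «K ⊂ S» TEST of slice `s`: admissible slice ∧ trig-admissible box ∧ polytope ∧ `VhiQ < (2/λ + λ/2)·L_U` (λ = 1/10). -/
def c5sliceTest (s : ℕ) : Bool :=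
  (SwingTube.legAt c5legs40 (s / 2)).sliceOK (c5sliceA s) (c5sliceB s) &&
    RelativeLff.boxOKQ (c5sliceBoxAt s) &&
    RelativeLff.polyOKQ NE39LPostCase5.angleLo NE39LPostCase5.angleHi (c5sliceBoxAt s) &&
    decide (RelativeLff.VhiQ NE39LPostCase5.data (1 / 10) NE39LPostCase5.angleLo NE39LPostCase5.angleHi (c5sliceBoxAt s) <
      (2 / (1 / 10 : ℚ) + (1 / 10 : ℚ) / 2) * NE39LPostCase5Lff.L_U)

/-- **KERNEL: slices 0 … 11 (clearing times `0 s ≤ T ≤ 0.03 s`) pass.** -/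
theorem sliceTest_a : ∀ s : Fin 12, c5sliceTest s = true := by
  decide +kernel

/-- **KERNEL: slices 12 … 23 (clearing times `0.03 s ≤ T ≤ 0.06 s`) pass.** -/
theorem sliceTest_b : ∀ s : Fin 12, c5sliceTest (s + 12) = true := by
  decide +kernel

/-- **KERNEL: slices 24 … 35 (clearing times `0.06 s ≤ T ≤ 0.09 s`) pass.** -/
theorem sliceTest_c : ∀ s : Fin 12, c5sliceTest (s + 24) = true := by
  decide +kernel

/-- **KERNEL: slices 36 … 42 (clearing times `0.09 s ≤ T ≤ 0.1075 s`) pass.** -/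
theorem sliceTest_d : ∀ s : Fin 7, c5sliceTest (s + 36) = true := by
  decide +kernel

/-- All 43 slices pass. -/
theorem sliceTest_all {s : ℕ} (hs : s < 43) : c5sliceTest s = true := by
  by_cases h0 : s < 12
  · exact sliceTest_a ⟨s, h0⟩
  · by_cases h1 : s < 24
    · have e : s = (s - 12) + 12 := by omega
      rw [e]
      exact sliceTest_b ⟨s - 12, by omega⟩
    · by_cases h2 : s < 36
      · have e : s = (s - 24) + 24 := by omega
        rw [e]
        exact sliceTest_c ⟨s - 24, by omega⟩
      · have e : s = (s - 36) + 36 := by omega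
        rw [e]
        exact sliceTest_d ⟨s - 36, by omega⟩

/-- Every clearing time `T ∈ [0, 43/400]` lies in one of the 43 slices. [folklore] -/
theorem cover {T : ℝ} (h0 : 0 ≤ T) (h1 : T ≤ 43 / 400) :
    ∃ s : ℕ, s < 43 ∧ (s : ℝ) / 400 ≤ T ∧ T ≤ ((s : ℝ) + 1) / 400 := by
  by_cases hlt : T < 42 / 400
  · have hf0 : (0 : ℝ) ≤ 400 * T := by linarith
    have hfl : (⌊400 * T⌋₊ : ℝ) ≤ 400 * T := Nat.floor_le hf0
    have hfu : 400 * T < (⌊400 * T⌋₊ : ℝ) + 1 := Nat.lt_floor_add_one _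
    refine ⟨⌊400 * T⌋₊, ?_, ?_, ?_⟩
    · have : (⌊400 * T⌋₊ : ℝ) < 43 := by linarith
      exact_mod_cast this
    · rw [div_le_iff₀ (by norm_num : (0 : ℝ) < 400)]; linarith
    · rw [le_div_iff₀ (by norm_num : (0 : ℝ) < 400)]; linarith
  · have hge := not_lt.mp hlt
    exact ⟨42, by norm_num, by linarith, by linarith⟩

/-! ### §2 The clearing-time lower bound -/

/-- **CCT(M′_NE39L, Padiyar 2013 Table 4.1 case 5: bolted fault at bus 14, line 14–34 TRIPPED at clearing (post-fault object NE39LPostCase5 ≠ pre-fault; feature (b))) ≥ 43/400 s — LEVEL-SET FORM.**  For every clearing time `T ∈ [0, 43/400]`, every solution `Y` of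
the FAULT-ON model `NE39L.FaultCase5.c5model` on `[0, T]` from the synchronous equilibrium of M′ (relative rotor angles `θ*`, all speeds `0`) and
every solution `c` of the POST-fault model M′_post = `NE39LPostCase5.data.toModelRel (1/10) 0` on `ℝ` with `c 0 = Y T`: there is an admissible
level `c₀ < (2/λ + λ/2)·L_U` such that the LFF state of `c` stays in `{y ∈ 𝒫 | V_{1/10} y ≤ c₀}` for all `t ≥ 0` and tends to `0`.
MODELLED: synthetic NE39L variant (MV-2L + MV-RD + MV-λ(1/10) + MV-h12); inner estimate; never the system's CCT.
[cite: VuTuritsyn2016, §IV set ℛ; Moore1979, §8.1 eq. (8.10); Padiyar2013, Table 4.1] -/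
theorem cct_lower {T : ℝ} (hT0 : 0 ≤ T) (hT : T ≤ 43 / 400)
    {Y : ℝ → ClassicalSwing.State 10} (hY : c5model.IsSolutionOn Y (Icc 0 T)) (hω0 : (Y 0).2 = 0)
    (hδ0 : ∀ i, (Y 0).1 i - (Y 0).1 0 = NE39L.data.angleOf i)
    {c : ℝ → ClassicalSwing.State 10} (hc : (NE39LPostCase5.data.toModelRel (1 / 10) 0).IsSolutionOn c univ) (hc0 : c 0 = Y T) :
    ∃ c₀ : ℝ, c₀ < (2 / ((1 / 10 : ℚ) : ℝ) + ((1 / 10 : ℚ) : ℝ) / 2) * (NE39LPostCase5Lff.L_U : ℝ) ∧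
      (∀ t, 0 ≤ t →
        RecastData.lffState NE39LPostCase5.data.angleOf (c t) ∈ (NE39LPostCase5.data.lffSystemU (1 / 10) NE39LPostCase5.data.angleOf).polytope ∧
          (NE39LPostCase5Lff.certU (1 / 10) (by norm_num)).V (RecastData.lffState NE39LPostCase5.data.angleOf (c t)) ≤ c₀) ∧
      Tendsto (fun t => RecastData.lffState NE39LPostCase5.data.angleOf (c t)) atTop (𝓝 0) := by
  obtain ⟨s, hs, hs1, hs2⟩ := cover hT0 hT
  have htest := sliceTest_all hs
  simp only [c5sliceTest, Bool.and_eq_true, decide_eq_true_eq] at htest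
  obtain ⟨⟨⟨hsl, hbox⟩, hpoly⟩, hlev⟩ := htest
  have hk : s / 2 < 40 := by omega
  have hsum : ((s / 2 : ℕ) : ℝ) / 200 + ((s % 2 : ℕ) : ℝ) / 400 = (s : ℝ) / 400 := by
    have e : ((2 * (s / 2) + s % 2 : ℕ) : ℝ) = (s : ℝ) := by exact_mod_cast Nat.div_add_mod s 2
    push_cast at e
    linarith
  have hA : ((c5sliceA s : ℚ) : ℝ) = ((s % 2 : ℕ) : ℝ) / 400 := by simp [c5sliceA]
  have hB : ((c5sliceB s : ℚ) : ℝ) = ((s % 2 : ℕ) : ℝ) / 400 + 1 / 400 := by simp [c5sliceB]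
  have hT1 : ((s / 2 : ℕ) : ℝ) / 200 + ((c5sliceA s : ℚ) : ℝ) ≤ T := by rw [hA]; linarith
  have hT2 : T ≤ ((s / 2 : ℕ) : ℝ) / 200 + ((c5sliceB s : ℚ) : ℝ) := by rw [hB]; linarith
  have hx : Y T ∈ (c5sliceBoxAt s).toSet := clearingState40 hk hsl hT1 hT2 hY hω0 hδ0
  have hV : (NE39LPostCase5Lff.certU (1 / 10) (by norm_num)).V (RecastData.lffState NE39LPostCase5.data.angleOf (Y T)) ≤
      ((RelativeLff.VhiQ NE39LPostCase5.data (1 / 10) NE39LPostCase5.angleLo NE39LPostCase5.angleHi (c5sliceBoxAt s) : ℚ) : ℝ) :=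
    RelativeLff.certU_V_le_VhiQ NE39LPostCase5.data (1 / 10) (by norm_num) _ NE39LPostCase5Lff.M_pos NE39LPostCase5Lff.nu_lt_Mμ NE39LPostCase5Lff.cs_criterion
      NE39LPostCase5.data_Cc_pos NE39LPostCase5.data_eqData NE39LPostCase5.angleLo_le NE39LPostCase5.angleOf_le_angleHi hbox hx
  have hP : RecastData.lffState NE39LPostCase5.data.angleOf (Y T) ∈ (NE39LPostCase5.data.lffSystemU (1 / 10) NE39LPostCase5.data.angleOf).polytope :=
    RelativeLff.lffState_mem_polytope_of_polyOKQ NE39LPostCase5.data (1 / 10) NE39LPostCase5.angleLo_le NE39LPostCase5.angleOf_le_angleHi hpoly hx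
  have hc₀ : ((RelativeLff.VhiQ NE39LPostCase5.data (1 / 10) NE39LPostCase5.angleLo NE39LPostCase5.angleHi (c5sliceBoxAt s) : ℚ) : ℝ) <
      (2 / ((1 / 10 : ℚ) : ℝ) + ((1 / 10 : ℚ) : ℝ) / 2) * (NE39LPostCase5Lff.L_U : ℝ) := by
    have h := (Rat.cast_lt (K := ℝ)).mpr hlev
    push_cast at h ⊢
    linarith
  refine ⟨_, hc₀, ?_⟩
  rw [← hc0] at hV hP
  exact NE39LPostCase5Lff.levelU_synchronisation (1 / 10) (by norm_num) 0 hc₀ hc hP hV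

/-- **CCT(M′_NE39L, Padiyar 2013 Table 4.1 case 5: bolted fault at bus 14, line 14–34 TRIPPED at clearing (post-fault object NE39LPostCase5 ≠ pre-fault; feature (b))) ≥ 43/400 s = 0.1075 s — MACHINE WORDS.**  Same hypotheses: after ANY clearing instant
`T ≤ 43/400 s` the post-fault motion SYNCHRONISES — for every machine `m = 1 … 9` (index 0 = GEN 2 = reference) the relative rotor angle
`δ_m − δ_0` tends to its POST-fault equilibrium value `θ*_m − θ*_0` (of `NE39LPostCase5`) and the relative speed `ω_m − ω_0` tends to `0`.  MODELLED: synthetic NE39L variant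
(MV-2L + MV-RD + MV-λ(1/10) + MV-h12), COI acceleration ≡ 0; an INNER estimate of the model's critical clearing time.
[cite: VuTuritsyn2016, §IV set ℛ; Padiyar2013, Table 4.1] -/
theorem cct_lower_sync {T : ℝ} (hT0 : 0 ≤ T) (hT : T ≤ 43 / 400)
    {Y : ℝ → ClassicalSwing.State 10} (hY : c5model.IsSolutionOn Y (Icc 0 T)) (hω0 : (Y 0).2 = 0)
    (hδ0 : ∀ i, (Y 0).1 i - (Y 0).1 0 = NE39L.data.angleOf i)
    {c : ℝ → ClassicalSwing.State 10} (hc : (NE39LPostCase5.data.toModelRel (1 / 10) 0).IsSolutionOn c univ) (hc0 : c 0 = Y T)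
    (m : Fin 9) :
    Tendsto (fun t => (c t).1 m.succ - (c t).1 0) atTop (𝓝 (NE39LPostCase5.data.angleOf m.succ - NE39LPostCase5.data.angleOf 0)) ∧
      Tendsto (fun t => (c t).2 m.succ - (c t).2 0) atTop (𝓝 0) := by
  obtain ⟨c₀, -, -, hlim⟩ := cct_lower hT0 hT hY hω0 hδ0 hc hc0
  rw [tendsto_pi_nhds] at hlim
  have h1 := hlim (Sum.inl m)
  have h2 := hlim (Sum.inr m)
  simp only [RecastData.lffState, Sum.elim_inl, Sum.elim_inr, Pi.zero_apply] at h1 h2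
  refine ⟨?_, h2⟩
  have e : (fun t => (c t).1 m.succ - (c t).1 0) =
      fun t => RecastData.u NE39LPostCase5.data.angleOf (c t) m.succ + (NE39LPostCase5.data.angleOf m.succ - NE39LPostCase5.data.angleOf 0) := by
    funext t; simp only [RecastData.u]; ring
  rw [e]
  have := h1.add_const (NE39LPostCase5.data.angleOf m.succ - NE39LPostCase5.data.angleOf 0)
  rwa [zero_add] at this

end Summit.Ventures.GridStability.Bench.NE39LCase5Cct

end

/- ERRATUM (gridfusion-model-1 g8, 2026-08-27, at gridfusion-ref-3 g9's request on its R2 row 133; COMMENT ONLY — every declaration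
above is byte-identical, no theorem statement or proof is touched).  The MODULE docstring (ll. 8–31) was emitted from the bus-14
NO-TRIP template and carries stale clauses for case 5 (post-fault object ≠ pre-fault object):
(D1) l.17 «c₀ = VhiQ(slice) < −1348.2422»: −1348.2422 = −6741211/5000 is the bus-14 NO-TRIP level (PRE-fault object).  The theorems
     `cct_lower` / `cct_lower_sync` prove `c₀ < (2/λ + λ/2) · NE39LPostCase5Lff.L_U = (401/20) · (−67147/1000) = −26925947/20000
     = −1346.29735`, the POST-case-5 level, for every slice `s < 43` (for slices 37–42 the docstring's number is false; the theorems'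
     level is the one decided by `c5sliceTest`).
(D2) l.18 «(p493380, … L_U = −67.244)»: p493380 and −67.244 are the PRE-fault `Lyapunov/NE39LLffLevel.lean` and its constant; the
     level theorem used here is lyap-1's `NE39LPostCase5Lff.levelU_synchronisation` of `Lyapunov/NE39LPostCase5Lff.lean` (p501469),
     `L_U = −67147/1000 = −67.147`.
(D3) l.24, first clause «V(θ*, 0) ≈ −1357.28, admissible levels < −1348.2422 ⇒ budget ≈ 9.04 V-units» is the bus-14 no-trip
     paragraph.  For case 5: `V_post(θ**, 0) ≈ −1354.60` at the POST-fault SEP θ**, admissible levels `< −1346.297` ⇒ budget ≈ 8.30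
     V-units; the PRE-fault equilibrium of record θ* has `V_post(θ*, 0) ≈ V_post(θ**, 0) + 0.15`, hence lies inside with margin 8.12
     at `T = 0` (the clause after the semicolon on l.24 is correct as printed).
(D4) l.31 print comparator: Padiyar's CCTs are in Table 4.3 (Table 4.1 defines the cases).  Case 5, CLASSICAL model: critical energy
     11.27 predicted / 11.97 simulated, CCT 0.25–0.26 s predicted / 0.26–0.27 s simulated; «0.34–0.35 s» is the two-axis + AVR
     (detailed-model) column.  All of these are DIFFERENT models from M′ — context only.  [cite: Padiyar2013, Table 4.3]
(D5) VALIDATED (i): a same-model float RK4 for this case exists — gridfusion-ref-1 g18's own (HOME INBOX 2026-08-27T21:56:49Z; their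
     lineage, quoted as theirs): no pole slip for clearing at 1.0188 s, pole slip at 1.0215 s.  The certified 43/400 s is ≈ 11 % of
     it: the LEVEL SET binds, not the dynamics (as on bus 37 / 14 / 8).
Reading aids of record for the sentence (ref-3 c5-1…c5-3): the theorems start from the EXACT pre-fault equilibrium (`hδ0`: relative
angles `= NE39L.data.angleOf`, speeds `0`) — the box `case5K0` is only the tube's enclosure of that point; the fault-on model
`NE39L.FaultCase5.c5model` already carries the POST-fault redispatch `P′`; the post-fault SEP θ** (`NE39LPostCase5.data.angleOf`) is not
in `case5K0` and is not claimed to be — feature (b)'s content is that the PRE-fault point lands inside the POST-fault level set. -/
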